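import Literature.Analysis.FluidPDE.TorusLinearisedNSH1Balance
import Literature.Analysis.FluidPDE.TorusLinearisedNSH2Balance
import HarnessLib

/-!
# `V → H²` smoothing of the linearised Navier–Stokes equation along a smooth field on `T³`

Analysis/FluidPDE proof file (theorems only; no definitions, no named facts), sequel of
`TorusLinearisedNSH2Balance.lean` (the `H²` balance of the first variation equation and its flux
bound on `T³`), `TorusLinearisedNSH1Balance.lean` (the `H¹` balance and the exponential `H¹`
bound) and `TorusLinearisedNSSmoothing.lean` (the `H → V` smoothing), one Sobolev level up. For a
jointly smooth solution `(w, q)` of the linearised Navier–Stokes equation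
`∂ₜw + (u·∇)w + (w·∇)u = νΔw − ∇q`, `div w = 0`, `∫ w = 0`, along a jointly smooth
divergence-free field `u` on `[a, a + τ] × T^d`, `card d = 3`, with `‖u‖ ≤ M`, `‖∂ᵢu‖ ≤ L` and
`‖Δu(t)‖₂² ≤ Y₁`, the theorem `Torus.linearisedNS_integral_norm_laplacian_sq_le_mul` is the
PARABOLIC SMOOTHING ESTIMATE of the derivative cocycle from `V` to `H² = D(A)`:

`‖Δw(a + τ)‖₂² ≤ C(d, ν, M, L, Y₁, τ) (∫ ‖w(a)‖² + ‖∇w(a)‖₂²)`,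

i.e. the solution operator `S'(t, u₀)` of the first variation equation maps `V` boundedly into
`D(A)` for `t > a` (Constantin–Foias 1988, Ch. 14, the discussion after (14.4), one level above
"`S'(t, u₀)` maps `H` into `V` boundedly", by the a priori estimates of Prop. 13.2 / Thm 10.6;
Temam 1997, Ch. VI §3.1). With Rellich (`D(A) ⊂ V` compactly) this is the compactness of the
derivative cocycle on `V` used in the multiplicative ergodic theory of the Navier–Stokes semiflow
(block N of the smooth-model construction for NS phases).

Proof (no time integrals), `E = ∫ ‖w‖²`, `G = ‖∇w‖₂²`, `Y = ‖Δw‖₂²`: the flux bound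
(`Torus.linearisedNS_laplacian_flux_le`) gives `(½Y)' ≤ K₁ (G + Y)`,
`K₁ = ν⁻¹(2dM² + 4d²L² + 2dK Y₁)`; the `H¹` balance with half the dissipation kept gives
`(½G)' ≤ −(ν/2) Y + ν⁻¹(dM² G + (dL)² E)` (`Torus.linearisedNS_half_gradNormSq_flux_le` at
`ν/2`); the weighted combination `Φ(s) = (s − a)·½Y(s) + κ·½G(s)` with `κ = (1 + 2τK₁)/ν` has
`Φ' ≤ β (E + G)(s)` (the `Y`-terms cancel), and `(E + G)(s) ≤ (E + G)(a) e^{K'τ}`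
(`Torus.linearisedNS_h1_le_mul_exp`); the fencing lemma (`image_le_of_deriv_right_le_deriv_boundary`)
gives `τ·½Y(a + τ) ≤ Φ(a + τ) ≤ κ·½G(a) + βτe^{K'τ}(E + G)(a)`. Deliberately NOT here: backward
estimates, `D(A) → D(A^{3/2})`, existence of linearised solutions, time derivatives.

## Mathlib / tree search

Tree (reused): `Torus.linearisedNS_hasDerivWithinAt_half_integral_norm_laplacian_sq`,
`Torus.linearisedNS_laplacian_flux_le` (`TorusLinearisedNSH2Balance`),
`Torus.linearisedNS_hasDerivWithinAt_half_gradNormSq`, `Torus.linearisedNS_half_gradNormSq_flux_le`,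
`Torus.linearisedNS_h1_le_mul_exp` (`TorusLinearisedNSH1Balance`); the pattern is
`Torus.linearisedNS_sub_mul_gradNormSq_le` (`TorusLinearisedNSSmoothing`) and
`Torus.IsClassicalNSSolutionOn.sub_mul_gradNormSq_sub_le`. Mathlib:
`image_le_of_deriv_right_le_deriv_boundary`. Searched `linearisedNS.*laplacian`, `LinearisedNSH2`,
`V → D(A)` for the linearised equation: nothing (the module docstrings of
`TorusLinearisedNSH1Balance` / `TorusLinearisedNSSmoothing` list it as not treated).

## References

* P. Constantin, C. Foias, *Navier–Stokes Equations*, Univ. Chicago Press 1988, Ch. 13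
  Prop. 13.2, Ch. 14, (14.2)–(14.4), and Thm 10.6. [ConstantinFoiasNSE1988]
* R. Temam, *Infinite-Dimensional Dynamical Systems in Mechanics and Physics*, 2nd ed.,
  Springer 1997, Ch. VI §3.1. [Temam1997]
-/

noncomputable section

open MeasureTheory Set Function Filter
open scoped ContDiff InnerProductSpace RealInnerProductSpace Topology

namespace Literature.Analysis.FluidPDE

open Literature.Analysis.FunctionSpaces

variable {d : Type*} [Fintype d] [DecidableEq d]

/-! ### The smoothing estimate -/

set_option maxHeartbeats 400000 in
/-- **`V → H²` smoothing of the linearised Navier–Stokes equation on `T³`.** On `T^d` with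
`card d = 3`, for `ν > 0`, coefficient levels `M`, `L`, `Y₁` and a time lapse `τ > 0` there is a
constant `C` such that: for every jointly smooth `u` on `[a, a + τ] × T^d` with divergence-free
slices, `‖u‖ ≤ M`, `‖∂ᵢu‖ ≤ L` and `∫ ‖Δu(t)‖² ≤ Y₁` there, and every jointly smooth `(w, q)`
with `div w(t) = 0`, `∫ w(t) = 0` and `∂ₜw + (u·∇)w + (w·∇)u = νΔw − ∇q` pointwise (one-sided
time derivative within `[a, a + τ]`),
`∫ ‖Δw(a + τ)‖² ≤ C (∫ ‖w(a)‖² + ‖∇w(a)‖₂²)` —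
the solution operator of the first variation equation maps `V` boundedly into `D(A)` for
`t > a` (Constantin–Foias 1988, Ch. 14, the discussion after (14.4), one Sobolev level above the
`H → V` bound, via the a priori estimates of Prop. 13.2 and Thm 10.6), with a constant depending on
`u` only through `M`, `L`, `Y₁` and on the time lapse. Proof: the `H²` balance with its flux bound
`(½‖Δw‖₂²)' ≤ K₁(‖∇w‖₂² + ‖Δw‖₂²)`, the `H¹` balance keeping half the dissipation
`(½‖∇w‖₂²)' ≤ −(ν/2)‖Δw‖₂² + ν⁻¹(dM²‖∇w‖₂² + (dL)² ∫‖w‖²)`, the exponential `H¹` bound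
`Torus.linearisedNS_h1_le_mul_exp`, and the fencing lemma for the weighted combination
`Φ(s) = (s − a)·½‖Δw‖₂² + κ·½‖∇w‖₂²`, `κ = (1 + 2τK₁)/ν`, whose `‖Δw‖₂²`-terms cancel.
[cite: ConstantinFoiasNSE1988, Ch. 14 (14.2)–(14.4) with Prop. 13.2 and Thm 10.6] -/
theorem Torus.linearisedNS_integral_norm_laplacian_sq_le_mul (hd : Fintype.card d = 3)
    {ν : ℝ} (hν : 0 < ν) (M L Y₁ : ℝ) {τ : ℝ} (hτ : 0 < τ) :
    ∃ C : ℝ, ∀ {a : ℝ} {u w : ℝ → UnitAddTorus d → EuclideanSpace ℝ d} {q : ℝ → UnitAddTorus d → ℝ},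
      Torus.IsSmoothSpaceTimeOn (Icc a (a + τ)) u → (∀ t ∈ Icc a (a + τ), Torus.IsDivFree (u t)) →
      (∀ t ∈ Icc a (a + τ), ∀ x, ‖u t x‖ ≤ M) →
      (∀ i, ∀ t ∈ Icc a (a + τ), ∀ x, ‖Torus.partialDeriv i (u t) x‖ ≤ L) →
      (∀ t ∈ Icc a (a + τ), ∫ x, ‖Torus.laplacian (u t) x‖ ^ 2 ≤ Y₁) →
      Torus.IsSmoothSpaceTimeOn (Icc a (a + τ)) w → Torus.IsSmoothSpaceTimeOn (Icc a (a + τ)) q →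
      (∀ t ∈ Icc a (a + τ), Torus.IsDivFree (w t)) →
      (∀ t ∈ Icc a (a + τ), Torus.HasZeroMean (w t)) →
      (∀ t ∈ Icc a (a + τ), ∀ x, Torus.timeDerivWithin (Icc a (a + τ)) w t x +
        Torus.convect (u t) (w t) x + Torus.convect (w t) (u t) x =
          ν • Torus.laplacian (w t) x - Torus.gradient (q t) x) →
      ∫ x, ‖Torus.laplacian (w (a + τ)) x‖ ^ 2 ≤
        C * ((∫ x, ‖w a x‖ ^ 2) + Torus.gradNormSq (w a)) := by
  obtain ⟨K, hK, hflux⟩ := Torus.linearisedNS_laplacian_flux_le (d := d) hd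
  have hν0 : ν ≠ 0 := hν.ne'
  have hd0 : (0 : ℝ) ≤ Fintype.card d := Nat.cast_nonneg _
  -- the constants (all depend on `d, ν, M, L, Y₁, τ` only)
  set Y₁' : ℝ := max Y₁ 0 with hY₁'
  have hY₁'0 : 0 ≤ Y₁' := le_max_right _ _
  set K₁ : ℝ := ν⁻¹ * (2 * Fintype.card d * M ^ 2 + 4 * Fintype.card d ^ 2 * L ^ 2 +
    2 * Fintype.card d * K * Y₁') with hK₁
  have hK₁0 : 0 ≤ K₁ := by positivity
  set κ : ℝ := (1 + 2 * τ * K₁) / ν with hκ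
  have hκ0 : 0 ≤ κ := by positivity
  set D : ℝ := Fintype.card d * M ^ 2 with hD
  have hD0 : 0 ≤ D := by positivity
  set Λ : ℝ := Fintype.card d * L with hΛ
  set β : ℝ := τ * K₁ + κ * ν⁻¹ * (D + Λ ^ 2) with hβ
  have hβ0 : 0 ≤ β := by positivity
  set K' : ℝ := 2 * Λ + (Λ ^ 2 + D) / ν with hK'
  refine ⟨κ / τ + 2 * β * Real.exp (K' * τ), fun {a u w q} hu hudiv hM hL hY₁ hw hq hwdiv hmean hlin => ?_⟩
  set b : ℝ := a + τ with hb
  have hab : a < b := by rw [hb]; linarith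
  have ha : a ∈ Icc a b := left_mem_Icc.2 hab.le
  have hbm : b ∈ Icc a b := right_mem_Icc.2 hab.le
  obtain ⟨i₀⟩ : Nonempty d := Fintype.card_pos_iff.1 (by rw [hd]; norm_num)
  have hL0 : 0 ≤ L := (norm_nonneg _).trans (hL i₀ a ha 0)
  have hΛ0 : 0 ≤ Λ := by positivity
  have hK'0 : 0 ≤ K' := by positivity
  have hsumL : ∑ _i : d, L = Λ := by rw [Finset.sum_const, Finset.card_univ, nsmul_eq_mul]
  -- the three energies along the solution
  set E : ℝ → ℝ := fun s => ∫ x, ‖w s x‖ ^ 2 with hE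
  set G : ℝ → ℝ := fun s => Torus.gradNormSq (w s) with hG
  set Y : ℝ → ℝ := fun s => ∫ x, ‖Torus.laplacian (w s) x‖ ^ 2 with hY
  have hE0 : ∀ s, 0 ≤ E s := fun s => integral_nonneg fun x => sq_nonneg _
  have hG0 : ∀ s, 0 ≤ G s := fun s => Torus.gradNormSq_nonneg _
  have hY0 : ∀ s, 0 ≤ Y s := fun s => integral_nonneg fun x => sq_nonneg _
  set G' : ℝ → ℝ := fun s => -ν * (∫ x, ‖Torus.laplacian (w s) x‖ ^ 2) +
    ∫ x, ⟪Torus.convect (u s) (w s) x + Torus.convect (w s) (u s) x, Torus.laplacian (w s) x⟫ with hG'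
  set Y' : ℝ → ℝ := fun s => -ν * Torus.gradNormSq (Torus.laplacian (w s)) -
    ∫ x, ⟪Torus.convect (u s) (w s) x + Torus.convect (w s) (u s) x,
      Torus.laplacian (Torus.laplacian (w s)) x⟫ with hY'
  -- the two balances
  have hdG : ∀ s ∈ Icc a b, HasDerivWithinAt (fun r => 2⁻¹ * G r) (G' s) (Icc a b) s := fun s hs =>
    Torus.linearisedNS_hasDerivWithinAt_half_gradNormSq hu hw hq hwdiv hlin hab hs
  have hdY : ∀ s ∈ Icc a b, HasDerivWithinAt (fun r => 2⁻¹ * Y r) (Y' s) (Icc a b) s := fun s hs =>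
    Torus.linearisedNS_hasDerivWithinAt_half_integral_norm_laplacian_sq hu hw hq hwdiv hlin hab hs
  -- the flux bounds: `G' ≤ -(ν/2) Y + ν⁻¹ (D G + Λ² E)`, `Y' ≤ K₁ (G + Y)`
  have hG'le : ∀ s ∈ Icc a b, G' s ≤ -(ν / 2) * Y s + ν⁻¹ * (D * G s + Λ ^ 2 * E s) := by
    intro s hs
    have h := Torus.linearisedNS_half_gradNormSq_flux_le (half_pos hν) (hu.isSmooth_slice hs)
      (hw.isSmooth_slice hs) (hM s hs) (C := fun _ => L) fun i x => hL i s hs x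
    simp only [hsumL] at h
    have h2 : (2 * (ν / 2))⁻¹ = ν⁻¹ := by
      congr 1; ring
    rw [h2] at h
    have hYs := hY0 s
    simp only [hG']
    linarith
  have hY'le : ∀ s ∈ Icc a b, Y' s ≤ K₁ * (G s + Y s) := by
    intro s hs
    have h := hflux hν (hu.isSmooth_slice hs) (hw.isSmooth_slice hs) (hmean s hs) (hM s hs)
      fun k x => hL k s hs x
    have hGs := hG0 s
    have hYs := hY0 s
    have hYu0 : 0 ≤ ∫ x, ‖Torus.laplacian (u s) x‖ ^ 2 := integral_nonneg fun x => sq_nonneg _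
    have h1 : 2 * Fintype.card d * K * (G s + Y s) * (∫ x, ‖Torus.laplacian (u s) x‖ ^ 2) ≤
        2 * Fintype.card d * K * (G s + Y s) * Y₁' :=
      mul_le_mul_of_nonneg_left ((hY₁ s hs).trans (le_max_left _ _)) (by positivity)
    have h3 : 0 ≤ 2 * Fintype.card d * M ^ 2 * G s := by positivity
    have h4 : 0 ≤ 4 * Fintype.card d ^ 2 * L ^ 2 * Y s := by positivity
    have h5 : 2 * Fintype.card d * M ^ 2 * Y s + 4 * Fintype.card d ^ 2 * L ^ 2 * G s +
        2 * Fintype.card d * K * (G s + Y s) * (∫ x, ‖Torus.laplacian (u s) x‖ ^ 2) ≤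
        (2 * Fintype.card d * M ^ 2 + 4 * Fintype.card d ^ 2 * L ^ 2 +
          2 * Fintype.card d * K * Y₁') * (G s + Y s) := by
      linarith [h1, h3, h4]
    calc Y' s ≤ ν⁻¹ * (2 * Fintype.card d * M ^ 2 * Y s + 4 * Fintype.card d ^ 2 * L ^ 2 * G s +
          2 * Fintype.card d * K * (G s + Y s) * ∫ x, ‖Torus.laplacian (u s) x‖ ^ 2) := h
      _ ≤ ν⁻¹ * ((2 * Fintype.card d * M ^ 2 + 4 * Fintype.card d ^ 2 * L ^ 2 +
          2 * Fintype.card d * K * Y₁') * (G s + Y s)) :=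
          mul_le_mul_of_nonneg_left h5 (inv_nonneg.2 hν.le)
      _ = K₁ * (G s + Y s) := by rw [hK₁]; ring
  -- the exponential `H¹` bound: `E + G ≤ (E a + G a) e^{K' τ}` on `[a, b]`
  have hH : ∀ s ∈ Icc a b, E s + G s ≤ (E a + G a) * Real.exp (K' * τ) := by
    intro s hs
    have h := Torus.linearisedNS_h1_le_mul_exp hν hu hudiv hw hq hwdiv hlin hM (C := fun _ => L) hL hs
    simp only [hsumL] at h
    refine h.trans (mul_le_mul_of_nonneg_left (Real.exp_le_exp.2 ?_) (add_nonneg (hE0 a) (hG0 a)))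
    have h1 : s - a ≤ τ := by rw [hb] at hs; linarith [hs.2]
    have h2 : 0 ≤ s - a := by linarith [hs.1]
    have h3 : 2 * Λ + (Λ ^ 2 + Fintype.card d * M ^ 2) / ν = K' := by rw [hK', hD]
    rw [h3]
    exact mul_le_mul_of_nonneg_left h1 hK'0
  -- the weighted combination `Φ(s) = (s - a) · ½Y(s) + κ · ½G(s)`
  set H₀ : ℝ := E a + G a with hH₀
  have hH₀0 : 0 ≤ H₀ := add_nonneg (hE0 a) (hG0 a)
  set γ : ℝ := β * (H₀ * Real.exp (K' * τ)) with hγ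
  have hγ0 : 0 ≤ γ := by positivity
  set Φ : ℝ → ℝ := fun s => (s - a) * (2⁻¹ * Y s) + κ * (2⁻¹ * G s) with hΦ
  set Φ' : ℝ → ℝ := fun s => (1 * (2⁻¹ * Y s) + (s - a) * Y' s) + κ * G' s with hΦ'
  have hdΦ : ∀ s ∈ Icc a b, HasDerivWithinAt Φ (Φ' s) (Icc a b) s := by
    intro s hs
    have h1 : HasDerivWithinAt (fun r => r - a) 1 (Icc a b) s := by
      have h := (hasDerivWithinAt_id s (Icc a b)).sub (hasDerivWithinAt_const s (Icc a b) a)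
      rw [sub_zero] at h
      exact h
    exact (h1.mul (hdY s hs)).add ((hdG s hs).const_mul κ)
  have hΦ'le : ∀ s ∈ Icc a b, Φ' s ≤ γ := by
    intro s hs
    have hs1 : 0 ≤ s - a := by linarith [hs.1]
    have hs2 : s - a ≤ τ := by rw [hb] at hs; linarith [hs.2]
    have hGs := hG0 s
    have hEs := hE0 s
    have hYs := hY0 s
    have h1 := hY'le s hs
    have h2 := hG'le s hs
    -- `(s - a) Y' ≤ τ K₁ (G + Y)`
    have h3 : (s - a) * Y' s ≤ τ * (K₁ * (G s + Y s)) := by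
      have hR : 0 ≤ K₁ * (G s + Y s) := by positivity
      calc (s - a) * Y' s ≤ (s - a) * (K₁ * (G s + Y s)) := mul_le_mul_of_nonneg_left h1 hs1
        _ ≤ τ * (K₁ * (G s + Y s)) := mul_le_mul_of_nonneg_right hs2 hR
    have h4 : κ * G' s ≤ κ * (-(ν / 2) * Y s + ν⁻¹ * (D * G s + Λ ^ 2 * E s)) :=
      mul_le_mul_of_nonneg_left h2 hκ0
    -- the `Y`-coefficient vanishes by the choice of `κ`
    have hcoef : 2⁻¹ + τ * K₁ - κ * (ν / 2) = 0 := by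
      rw [hκ]; field_simp; ring
    have h5 := hH s hs
    have h6 : (τ * K₁ + κ * ν⁻¹ * D) * G s + κ * ν⁻¹ * Λ ^ 2 * E s ≤ β * (E s + G s) := by
      rw [hβ]
      have h7 : 0 ≤ τ * K₁ * E s := by positivity
      have h8 : 0 ≤ κ * ν⁻¹ * D * E s := by positivity
      have h9 : 0 ≤ κ * ν⁻¹ * Λ ^ 2 * G s := by positivity
      linarith [h7, h8, h9]
    calc Φ' s = 2⁻¹ * Y s + (s - a) * Y' s + κ * G' s := by simp only [hΦ', one_mul]
      _ ≤ 2⁻¹ * Y s + τ * (K₁ * (G s + Y s)) +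
          κ * (-(ν / 2) * Y s + ν⁻¹ * (D * G s + Λ ^ 2 * E s)) := by linarith [h3, h4]
      _ = (2⁻¹ + τ * K₁ - κ * (ν / 2)) * Y s +
          ((τ * K₁ + κ * ν⁻¹ * D) * G s + κ * ν⁻¹ * Λ ^ 2 * E s) := by ring
      _ = (τ * K₁ + κ * ν⁻¹ * D) * G s + κ * ν⁻¹ * Λ ^ 2 * E s := by rw [hcoef, zero_mul, zero_add]
      _ ≤ β * (E s + G s) := h6
      _ ≤ β * (H₀ * Real.exp (K' * τ)) := mul_le_mul_of_nonneg_left h5 hβ0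
      _ = γ := by rw [hγ]
  -- fencing on `[a, b]`
  have hΦc : ContinuousOn Φ (Icc a b) := fun s hs => (hdΦ s hs).continuousWithinAt
  have hΦr : ∀ s ∈ Ico a b, HasDerivWithinAt Φ (Φ' s) (Ici s) s := fun s hs =>
    ((hdΦ s (Ico_subset_Icc_self hs)).mono (Icc_subset_Icc hs.1 le_rfl)).mono_of_mem_nhdsWithin
      (Icc_mem_nhdsGE hs.2)
  have hfence := image_le_of_deriv_right_le_deriv_boundary hΦc hΦr
    (B := fun s => Φ a + γ * (s - a)) (B' := fun _ => γ) (by simp) (by fun_prop)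
    (fun s _ => by
      have h1 : HasDerivWithinAt (fun r => Φ a + γ * (r - a)) (0 + γ * (1 - 0)) (Ici s) s :=
        (hasDerivWithinAt_const _ _ _).add (((hasDerivWithinAt_id _ _).sub
          (hasDerivWithinAt_const _ _ _)).const_mul γ)
      simpa using h1)
    (fun s hs => hΦ'le s (Ico_subset_Icc_self hs)) hbm
  have hfence' : Φ b ≤ Φ a + γ * (b - a) := hfence
  -- unwind
  have hΦa : Φ a = κ * (2⁻¹ * G a) := by simp only [hΦ, sub_self, zero_mul, zero_add]
  have hba : b - a = τ := by rw [hb]; ring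
  have hlow : (b - a) * (2⁻¹ * Y b) ≤ Φ b :=
    le_add_of_nonneg_right (mul_nonneg hκ0 (mul_nonneg (by norm_num) (hG0 b)))
  rw [hba] at hlow hfence'
  have hGa : G a ≤ H₀ := le_add_of_nonneg_left (hE0 a)
  have hκG : κ * (2⁻¹ * G a) ≤ κ * (2⁻¹ * H₀) := by gcongr
  have hmain : τ * Y b ≤ κ * H₀ + 2 * β * Real.exp (K' * τ) * H₀ * τ := by
    have : τ * (2⁻¹ * Y b) ≤ κ * (2⁻¹ * H₀) + β * (H₀ * Real.exp (K' * τ)) * τ := by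
      linarith [hlow, hfence', hΦa, hκG]
    linarith [this]
  have hτ0 : τ ≠ 0 := hτ.ne'
  have hfin : Y b ≤ (κ / τ + 2 * β * Real.exp (K' * τ)) * H₀ := by
    calc Y b = τ⁻¹ * (τ * Y b) := by field_simp
      _ ≤ τ⁻¹ * (κ * H₀ + 2 * β * Real.exp (K' * τ) * H₀ * τ) :=
          mul_le_mul_of_nonneg_left hmain (inv_nonneg.2 hτ.le)
      _ = (κ / τ + 2 * β * Real.exp (K' * τ)) * H₀ := by
          field_simp
  exact hfin

end Literature.Analysis.FluidPDE

end
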